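import Literature.NumberTheory.Rogawski1990.ArchBouazizStableFamilyCayleyValue   -- ★ p850153 LH5-p04 (g2): (I₂@cayPt) closed form + §2 product calculus `archRH_mul_stableSum_eq_mul_prod`
import Literature.NumberTheory.Automorphic.ArchRankOneJumpZeroStable           -- ★ p850182 (this seat): the `w₀`-factor «stable sum jumps by 2i·C₁·cone»
import HarnessLib

/-!
# (J-H) ORDER 0 — the genuine stable orbital family `stOrbFamH L νH fH` JUMPS at a noncompact imaginary wall: the jump VALUE (§2; its reading as `cH · Ψ_{S′}(cayPt)` is ED. 2)
# (Shelstad 1979 Lemma 4.3, Thm. 4.7 (IIIb); Bouaziz 1994 §3.2 (I₃), §6.2; Rogawski 1990 §8.2)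

Topic `NumberTheory/Rogawski1990`; namespace `Literature.NumberTheory.Rogawski1990`.  THEOREMS ONLY (no `def`, no instance, no notation, no axiom, no named fact, no `sorry`).
Cell `pub/hodgecm-mathlib`, line LH3 (closer stub `stub_N9`, crux H413 = `stmt-HodgeConjecture-24833`), DIRECT ROAD organ **(J-H) «ORDER-0 (I₃) FOR THE GENUINE STABLE FAMILIES
OF `H_∞`»** — the HEAD (LH3-plan (g3) 2026-09-02T07:18:44Z → LH10-p02 (g3)), in the PRODUCT-READING currency of ★ (I₂@cayPt) `ArchBouazizStableFamilyCayleyValue` (LH5-p04):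
the test function is read through (PROD-QUOT-H)'s product form `chartOrbH L νH S fH c = G c · ∏_w φ w (c w)` ON `RegS S` (hypothesis `hP`, (P1)), and the `w₀`-local
functional of the COMPACT chart at `w₀ ∉ S` is read as a constant `κ` times the group orbital integral over `U(Φ₂)_{w₀}` along the Cayley torus (hypothesis `hQ`: the
quotient-vs-group rider at a compact place, `κ = dt(B_{S,w₀})∕dt(T_{S,w₀})`, (PROD-QUOT-H) currency).

THE MATHEMATICS.  Along the normal curve `c_ν = s + ν • nrm w₀` of the wall `θ₀ = θ₂` at `w₀ ∉ S` (`s` semiregular: `s w₀ 0 = s w₀ 2`, regular elsewhere), for `0 < |ν| < 1`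
the point `c_ν` is REGULAR (§1), so ★ `stOrbFamH_of_mem_regS` + ★ `archRH_mul_stableSum_eq_mul_prod` read
`stOrbFamH L νH fH S c_ν = G(s) · ∏_{w ≠ w₀} L_w(s w) · L_{w₀}(ν)` — every spectator factor is LITERALLY constant (the curve moves only the slots `(w₀,0), (w₀,2)`; `G` reads
slot 1, hypothesis `hG1`) — with `L_{w₀}(ν) = (1 − e^{i(θ₂−θ₀)})·(φ_{w₀}(c_ν w₀) + φ_{w₀}(flip)) = κ · (1 − e^{−2iν}) · (Φ(ν) + Φ(−ν))`, `Φ(ν) = ∫_{U(Φ₂)_{w₀}} f₀(h·(P diag(z e^{iν},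
z e^{−iν}) P⁻¹)·h⁻¹) dν₀`, `z = e^{i s_{w₀,0}}` — EXACTLY ★ p850182's stable normalised sum, which jumps by `2i · C₁ · cone(f₀, z)`.  Hence (§2)
**`HasOneSidedJump (ν ↦ stOrbFamH L νH fH S (s + ν • nrm w₀)) (G s · ∏_{w ≠ w₀} L_w(s w) · κ · 2i C₁ · cone(f₀, z))`** — the ORDER-0 JUMP VALUE, with NO split-side input.
§3 docks with ★ (I₂@cayPt) `stOrbFamH_insert_cayPt_eq_mul_prod_of_continuousAt`: if the split chart `S′ = insert w₀ S` has the product reading with the SAME spectator functionals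
and its `w₀`-factor has the (A0) limit `ℓ₀` at the Cayley point, then for ANY `cH` with `cH · ℓ₀ = κ · 2i C₁ · cone(f₀, z)` the jump is **`cH · stOrbFamH L νH fH S′ (cayPt w₀ s)`**
— the (I₃) order-0 clause (★ `ArchBzJump.order_zero` shape); (A0-b)∕(A0-c) (F0P3a-p05 ∕ LH3-p01: `ℓ₀ = C₂ · κ′ · cone(f₀, z)` with the same cone functional) then give the UNIFORM
`cH w₀ = 2i C₁ κ ∕ (C₂ κ′)`, independent of `S`, `s`, `fH`.
HONEST LABEL: HC_CM is proved only modulo the 7 printed citations (2 remaining: hLiu418 = stmt-HodgeConjecture-24832, h413 = stmt-HodgeConjecture-24833) until rung 0 closes;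
count-neutral; (P1) and the compact-place rider enter BY STATEMENT (`hP`, `hQ`) until (PROD-QUOT-H)'s P-files ★ them, (A0) enters §3 only through `ℓ₀` and the matching equation.

WHAT IS PROVED.  §1 `HasOneSidedJump.const_mul`, `HasOneSidedJump.congr_nhdsWithin` (eventual congruence on both sides), `add_smul_nrm_mem_regS` (regularity of the normal curve for
`0 < |ν| < 1`), `circleExp_add_smul_nrm₀∕₂` (the Cayley-torus angles `z e^{±iν}`).  §2 **`exists_hasOneSidedJump_stOrbFamH_add_smul_nrm`** (the jump VALUE).  NOT HERE
(ED. 2, when (A0-b)∕(A0-c) post their heads): §3 `exists_hasOneSidedJump_stOrbFamH_cayPt` — the (I₃) order-0 reading `cH · stOrbFamH L νH fH (insert w₀ S) (cayPt w₀ s)` through ★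
`stOrbFamH_insert_cayPt_eq_mul_prod_of_continuousAt` and the matching equation `cH · ℓ₀ = κ · 2i C₁ · cone(f₀, z)`.

## References
* [Shelstad1979] D. Shelstad, *Characters and inner forms of a quasi-split group over ℝ*, Compositio Math. 39 (1979), Lemma 4.3 p. 25, Thm. 4.7 (IIIb) p. 31.
* [Bouaziz1994IntegralesOrbitales] A. Bouaziz, *Intégrales orbitales sur les groupes de Lie réductifs*, Ann. Sci. ÉNS 27 (1994), §3.2 (I₃) p. 580, §6.2 p. 591.
* [Rogawski1990] J. D. Rogawski, *Automorphic Representations of Unitary Groups in Three Variables*, Ann. of Math. Stud. 123 (1990), §4.1 (4.1.1) p. 39, §8.2 pp. 119, 122.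
* [Varadarajan1989] V. S. Varadarajan, *An Introduction to Harmonic Analysis on Semisimple Lie Groups* (1989), §6.4 Thm 23.
-/

set_option autoImplicit false

noncomputable section

open Filter Topology MeasureTheory NumberField NumberField.InfinitePlace Complex Set Function Real
open Literature.NumberTheory.Automorphic Literature.NumberTheory.Automorphic.UnitaryGroup Literature.NumberTheory.Automorphic.ArchCartan
open Literature.NumberTheory.Automorphic.Shelstad1979.StableOrbitalIntegrals
open scoped MatrixGroups

namespace Literature.NumberTheory.Rogawski1990

/-! ## §1 One-sided-jump bookkeeping and the normal curve -/

section Generic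

variable {W : Type*} [Fintype W] [DecidableEq W]

omit [Fintype W] [DecidableEq W] in
/-- A constant multiple of a function with a one-sided jump has the scaled jump. [cite: Shelstad1979, §4 p. 22] -/
theorem HasOneSidedJump.const_mul {F : ℝ → ℂ} {J : ℂ} (a : ℂ) (h : HasOneSidedJump F J) :
    HasOneSidedJump (fun ν => a * F ν) (a * J) := by
  obtain ⟨Lp, Lm, hp, hm, hJ⟩ := h
  exact ⟨a * Lp, a * Lm, hp.const_mul a, hm.const_mul a, by rw [← hJ]; ring⟩

omit [Fintype W] [DecidableEq W] in
/-- One-sided jumps only see the function on punctured one-sided neighbourhoods of `0`. [cite: Shelstad1979, §4 p. 22] -/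
theorem HasOneSidedJump.congr_nhdsWithin {F G : ℝ → ℂ} {J : ℂ} (h : HasOneSidedJump F J)
    (hp : G =ᶠ[𝓝[>] (0 : ℝ)] F) (hm : G =ᶠ[𝓝[<] (0 : ℝ)] F) : HasOneSidedJump G J := by
  obtain ⟨Lp, Lm, h1, h2, hJ⟩ := h
  exact ⟨Lp, Lm, h1.congr' hp.symm, h2.congr' hm.symm, hJ⟩

omit [Fintype W] [DecidableEq W] in
/-- Rewriting the jump value. [cite: Shelstad1979, §4 p. 22] -/
theorem HasOneSidedJump.jump_congr {F : ℝ → ℂ} {J J' : ℂ} (h : HasOneSidedJump F J) (hJ : J = J') : HasOneSidedJump F J' := hJ ▸ h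

omit [Fintype W] in
/-- **The normal curve is REGULAR for `0 < |ν| < 1`**: at a semiregular wall point `s` of the wall `θ₀ = θ₂` at `w₀ ∉ S` (regular at the other places), `s + ν • nrm w₀ ∈ RegS S`
(the two angles `s₀ ± ν` differ by `2ν ∉ 2πℤ`). [cite: Shelstad1979, Lemma 4.3 p. 25] [cite: Rogawski1990, §8.2 p. 122] -/
theorem add_smul_nrm_mem_regS (S : Finset W) {w₀ : W} (hw₀ : w₀ ∉ S) {s : W → Fin 3 → ℝ} (hs : s w₀ 0 = s w₀ 2)
    (hreg : ∀ w, w ∉ S → w ≠ w₀ → Circle.exp (s w 0) ≠ Circle.exp (s w 2)) (hregS : ∀ w ∈ S, s w 0 ≠ 0)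
    {ν : ℝ} (hν : ν ∈ Ioo (-1 : ℝ) 1) (hν0 : ν ≠ 0) : s + ν • nrm w₀ ∈ RegS S := by
  refine ⟨fun w hw => ?_, fun w hw => ?_⟩
  · by_cases hww : w = w₀
    · subst hww
      rw [add_smul_nrm_apply_self]
      simp only [Matrix.cons_val_zero, Matrix.cons_val_two, Matrix.tail_cons, Matrix.head_cons]
      intro h
      rw [Circle.exp_eq_exp] at h
      obtain ⟨m, hm⟩ := h
      have hm' : (m : ℝ) * π = ν := by linarith
      have hm0 : m = 0 := by
        by_contra hne
        have h1 : (1 : ℝ) ≤ |(m : ℝ)| := by exact_mod_cast Int.one_le_abs hne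
        have habs : |(m : ℝ)| * π < 1 := by
          rw [← abs_of_pos Real.pi_pos, ← abs_mul, hm']; exact abs_lt.2 ⟨hν.1, hν.2⟩
        nlinarith [Real.pi_gt_three, abs_nonneg (m : ℝ)]
      subst hm0
      simp at hm'
      exact hν0 hm'.symm
    · rw [add_smul_nrm_apply_of_ne s ν hww]
      exact hreg w hw hww
  · have hww : w ≠ w₀ := fun h => hw₀ (h ▸ hw)
    rw [add_smul_nrm_apply_of_ne s ν hww]
    exact hregS w hw

omit [Fintype W] in
/-- Along the normal curve the first 2-block angle is `e^{i(s₀+ν)} = z · e^{iν}`, `z = e^{i s₀}`. [cite: Rogawski1990, §8.2 p. 122] -/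
theorem circleExp_add_smul_nrm₀ (s : W → Fin 3 → ℝ) (ν : ℝ) (w₀ : W) :
    Circle.exp ((s + ν • nrm w₀) w₀ 0) = Circle.exp (s w₀ 0) * Circle.exp ν := by
  rw [add_smul_nrm_apply_self]
  simp only [Matrix.cons_val_zero, Circle.exp_add]

omit [Fintype W] in
/-- Along the normal curve the second 2-block angle is `e^{i(s₂−ν)} = z · e^{−iν}` on the wall `s₀ = s₂`. [cite: Rogawski1990, §8.2 p. 122] -/
theorem circleExp_add_smul_nrm₂ (s : W → Fin 3 → ℝ) (ν : ℝ) (w₀ : W) (hs : s w₀ 0 = s w₀ 2) :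
    Circle.exp ((s + ν • nrm w₀) w₀ 2) = Circle.exp (s w₀ 0) * Circle.exp (-ν) := by
  rw [add_smul_nrm_apply_self]
  simp only [Matrix.cons_val_two, Matrix.tail_cons, Matrix.head_cons]
  rw [← hs, sub_eq_add_neg, Circle.exp_add]

omit [Fintype W] in
/-- The slot-1 coordinate does not move along the normal curve. [cite: Rogawski1990, §8.2 p. 122] -/
theorem add_smul_nrm_apply_one (s : W → Fin 3 → ℝ) (ν : ℝ) (w₀ w : W) : (s + ν • nrm w₀) w 1 = s w 1 := by
  by_cases hww : w = w₀
  · subst hww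
    rw [add_smul_nrm_apply_self]
    simp only [Matrix.cons_val_one, Matrix.cons_val_zero]
  · rw [add_smul_nrm_apply_of_ne s ν hww]

omit [Fintype W] in
/-- The Weyl normaliser at `w₀` along the normal curve: `1 − e^{i(θ₂−θ₀)} = 1 − e^{−2iν}`. [cite: Shelstad1979, §4 p. 22] -/
theorem one_sub_circleExp_add_smul_nrm (s : W → Fin 3 → ℝ) (ν : ℝ) (w₀ : W) (hs : s w₀ 0 = s w₀ 2) :
    (1 : ℂ) - (Circle.exp ((s + ν • nrm w₀) w₀ 2 - (s + ν • nrm w₀) w₀ 0) : ℂ) = 1 - cexp (-(2 * (ν : ℂ) * I)) := by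
  rw [add_smul_nrm_apply_self]
  simp only [Matrix.cons_val_zero, Matrix.cons_val_two, Matrix.tail_cons, Matrix.head_cons]
  rw [← hs, show s w₀ 0 - ν - (s w₀ 0 + ν) = -(2 * ν) by ring, Circle.coe_exp]
  push_cast
  ring_nf

end Generic

/-! ## §2 The ORDER-0 JUMP VALUE of `stOrbFamH` at a noncompact imaginary wall (product reading; no split-side input) -/

section Jump

open scoped Classical

variable (L : Type) [Field L] [NumberField L] [IsCMField L]
  [MeasurableSpace (↥(arch (↥(maximalRealSubfield L)) L (IsCMField.complexConj L) 2 (Matrix.of fun i j : Fin 2 => if i.val + j.val + 1 = 2 then (1 : L) else 0)) ×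
      ↥(arch (↥(maximalRealSubfield L)) L (IsCMField.complexConj L) 1 (Matrix.of fun i j : Fin 1 => if i.val + j.val + 1 = 1 then (1 : L) else 0)))]
  [BorelSpace (↥(arch (↥(maximalRealSubfield L)) L (IsCMField.complexConj L) 2 (Matrix.of fun i j : Fin 2 => if i.val + j.val + 1 = 2 then (1 : L) else 0)) ×
      ↥(arch (↥(maximalRealSubfield L)) L (IsCMField.complexConj L) 1 (Matrix.of fun i j : Fin 1 => if i.val + j.val + 1 = 1 then (1 : L) else 0)))]
  (νH : Measure (↥(arch (↥(maximalRealSubfield L)) L (IsCMField.complexConj L) 2 (Matrix.of fun i j : Fin 2 => if i.val + j.val + 1 = 2 then (1 : L) else 0)) ×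
      ↥(arch (↥(maximalRealSubfield L)) L (IsCMField.complexConj L) 1 (Matrix.of fun i j : Fin 1 => if i.val + j.val + 1 = 1 then (1 : L) else 0))))
  [IsFiniteMeasureOnCompacts νH] [νH.IsMulRightInvariant]
  (w₀ : {w : InfinitePlace L // IsComplex w})
  [MeasurableSpace (archLocal L 2 (Matrix.of fun i j : Fin 2 => if i.val + j.val + 1 = 2 then (1 : L) else 0) w₀)]
  [BorelSpace (archLocal L 2 (Matrix.of fun i j : Fin 2 => if i.val + j.val + 1 = 2 then (1 : L) else 0) w₀)]
  (ν₀ : Measure (archLocal L 2 (Matrix.of fun i j : Fin 2 => if i.val + j.val + 1 = 2 then (1 : L) else 0) w₀)) [ν₀.IsHaarMeasure]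

/-- **(J-H) ORDER 0 — THE JUMP VALUE.**  There is ONE `C₁ > 0` (★ p850182's, depending on the Haar measure `ν₀` of `U(Φ₂)_{w₀}` only) such that: for every `fH` whose chart
functional on `S` (`w₀ ∉ S`) has the PRODUCT READING `chartOrbH L νH S fH c = G c · ∏_w φ w (c w)` on `RegS S` (`hP`; (PROD-QUOT-H) (P1)) with `G` reading slot `1` only (`hG1`)
and the `w₀`-functional read on the Cayley torus as `φ w₀ v = κ · ∫_{U(Φ₂)_{w₀}} f₀(h·(P diag(e^{i v₀}, e^{i v₂}) P⁻¹)·h⁻¹) dν₀` (`hQ`; `f₀` continuous with compact support), at every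
semiregular wall point `s` of the noncompact imaginary wall `θ₀ = θ₂` at `w₀` the stable orbital family along the normal curve has both one-sided limits and JUMPS BY
`G s · (∏_{w ≠ w₀} L_w(s w)) · (κ · 2i · C₁ · cone(f₀, e^{i s₀}))`, `L_w` the regular local factors of ★ `archRH_mul_stableSum_eq_mul_prod` and `cone` the two-nappe cone
integral of ★ p850055 (Cayley frame). [cite: Shelstad1979, Lemma 4.3 p. 25; Thm. 4.7 (IIIb) p. 31] [cite: Bouaziz1994IntegralesOrbitales, §3.2 (I₃) p. 580; §6.2 p. 591]
[cite: Rogawski1990, §8.2 pp. 119, 122] -/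
theorem exists_hasOneSidedJump_stOrbFamH_add_smul_nrm :
    ∃ C₁ : ℝ, 0 < C₁ ∧
      ∀ (fH : ↥(arch (↥(maximalRealSubfield L)) L (IsCMField.complexConj L) 2 (Matrix.of fun i j : Fin 2 => if i.val + j.val + 1 = 2 then (1 : L) else 0)) ×
          ↥(arch (↥(maximalRealSubfield L)) L (IsCMField.complexConj L) 1 (Matrix.of fun i j : Fin 1 => if i.val + j.val + 1 = 1 then (1 : L) else 0)) → ℂ)
        (S : Finset {w : InfinitePlace L // IsComplex w}) (_ : w₀ ∉ S)
        (s : {w : InfinitePlace L // IsComplex w} → Fin 3 → ℝ) (_ : s w₀ 0 = s w₀ 2)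
        (_ : ∀ w, w ∉ S → w ≠ w₀ → Circle.exp (s w 0) ≠ Circle.exp (s w 2)) (_ : ∀ w ∈ S, s w 0 ≠ 0)
        (G : ({w : InfinitePlace L // IsComplex w} → Fin 3 → ℝ) → ℂ) (φ : {w : InfinitePlace L // IsComplex w} → (Fin 3 → ℝ) → ℂ)
        (_ : ∀ c ∈ RegS S, chartOrbH L νH S fH c = G c * ∏ w, φ w (c w))
        (_ : ∀ c c' : {w : InfinitePlace L // IsComplex w} → Fin 3 → ℝ, (∀ w, c w 1 = c' w 1) → G c = G c')
        (κ : ℂ) (f₀ : Matrix (Fin 2) (Fin 2) ℂ → ℂ) (_ : Continuous f₀) (_ : HasCompactSupport f₀)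
        (_ : ∀ v : Fin 3 → ℝ, φ w₀ v = κ *
          ∫ h : archLocal L 2 (Matrix.of fun i j : Fin 2 => if i.val + j.val + 1 = 2 then (1 : L) else 0) w₀,
            f₀ (((h * ⟨Matrix.GeneralLinearGroup.mkOfDetNeZero !![(1 : ℂ), 1; 1, -1] det_cayleyTwo_ne_zero *
                  circleDiagonal 2 ![Circle.exp (v 0), Circle.exp (v 2)] *
                  (Matrix.GeneralLinearGroup.mkOfDetNeZero !![(1 : ℂ), 1; 1, -1] det_cayleyTwo_ne_zero)⁻¹,
                cayley_conj_circleDiagonal_mem_archLocal L w₀ _⟩ * h⁻¹ :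
              archLocal L 2 (Matrix.of fun i j : Fin 2 => if i.val + j.val + 1 = 2 then (1 : L) else 0) w₀) : GL (Fin 2) ℂ) : Matrix (Fin 2) (Fin 2) ℂ) ∂ν₀),
        HasOneSidedJump (fun ν : ℝ => stOrbFamH L νH fH S (s + ν • nrm w₀))
          (G s * (∏ w ∈ Finset.univ.erase w₀, (if w ∈ S then (((|Real.exp (s w 0) - Real.exp (-s w 0)| : ℝ) : ℂ) * φ w (s w))
              else (1 - (Circle.exp (s w 2 - s w 0) : ℂ)) * (φ w (s w) + φ w ![s w 2, s w 1, s w 0]))) *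
            (κ * (2 * I * ((C₁ : ℂ) * ((∫ p in Ioi (0 : ℝ) ×ˢ Ioc (0 : ℝ) (2 * π),
                f₀ ((!![(1 : ℂ), 1; 1, -1] : Matrix (Fin 2) (Fin 2) ℂ) *
                  (((Circle.exp (s w₀ 0) : Circle) : ℂ) • (1 : Matrix (Fin 2) (Fin 2) ℂ) +
                    p.1 • Matrix.diagonal ![((Circle.exp (s w₀ 0) : Circle) : ℂ) * I, -(((Circle.exp (s w₀ 0) : Circle) : ℂ) * I)] +
                    p.1 • !![(0 : ℂ), -(((Circle.exp (s w₀ 0) : Circle) : ℂ) * I) * cexp (-((p.2 : ℂ) * I));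
                      (((Circle.exp (s w₀ 0) : Circle) : ℂ) * I) * cexp ((p.2 : ℂ) * I), 0]) *
                  !![(1 / 2 : ℂ), 1 / 2; 1 / 2, -(1 / 2)])) +
              ∫ p in Ioi (0 : ℝ) ×ˢ Ioc (0 : ℝ) (2 * π),
                f₀ ((!![(1 : ℂ), 1; 1, -1] : Matrix (Fin 2) (Fin 2) ℂ) *
                  (((Circle.exp (s w₀ 0) : Circle) : ℂ) • (1 : Matrix (Fin 2) (Fin 2) ℂ) +
                    p.1 • Matrix.diagonal ![-(((Circle.exp (s w₀ 0) : Circle) : ℂ) * I), ((Circle.exp (s w₀ 0) : Circle) : ℂ) * I] +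
                    p.1 • !![(0 : ℂ), (((Circle.exp (s w₀ 0) : Circle) : ℂ) * I) * cexp (-((p.2 : ℂ) * I));
                      -(((Circle.exp (s w₀ 0) : Circle) : ℂ) * I) * cexp ((p.2 : ℂ) * I), 0]) *
                  !![(1 / 2 : ℂ), 1 / 2; 1 / 2, -(1 / 2)])))))) := by
  obtain ⟨C₁, hC₁, hst⟩ := exists_hasOneSidedJump_stableSum_cayley L w₀ ν₀
  refine ⟨C₁, hC₁, fun fH S hw₀ s hs hreg hregS G φ hP hG1 κ f₀ hf₀ hf₀c hQ => ?_⟩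
  -- the `w₀`-factor: ★ p850182 at `z = e^{i s₀}`, scaled by the constant spectator product
  set z : Circle := Circle.exp (s w₀ 0) with hz
  set A : ℂ := G s * ∏ w ∈ Finset.univ.erase w₀, (if w ∈ S then (((|Real.exp (s w 0) - Real.exp (-s w 0)| : ℝ) : ℂ) * φ w (s w))
      else (1 - (Circle.exp (s w 2 - s w 0) : ℂ)) * (φ w (s w) + φ w ![s w 2, s w 1, s w 0])) with hA
  have hjump := HasOneSidedJump.const_mul (A * κ) (hst f₀ hf₀ hf₀c z)
  -- flip invariance of `G` (it reads slot 1 only)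
  have hG : ∀ T : Finset {w : InfinitePlace L // IsComplex w}, (∀ w ∈ T, w ∉ S) → ∀ c, G (flipSet T c) = G c := fun T _ c =>
    hG1 _ _ fun w => by rw [flipSet_apply]; split_ifs <;> simp
  -- on the punctured neighbourhood `0 < |ν| < 1` the family IS `A · κ · (stable normalised sum)`
  have key : ∀ ν ∈ Ioo (-1 : ℝ) 1, ν ≠ 0 → stOrbFamH L νH fH S (s + ν • nrm w₀) =
      A * κ * (((1 : ℂ) - cexp (-(2 * (ν : ℂ) * I))) *
        ((∫ h : archLocal L 2 (Matrix.of fun i j : Fin 2 => if i.val + j.val + 1 = 2 then (1 : L) else 0) w₀,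
            f₀ (((h * ⟨Matrix.GeneralLinearGroup.mkOfDetNeZero !![(1 : ℂ), 1; 1, -1] det_cayleyTwo_ne_zero *
                  circleDiagonal 2 ![z * Circle.exp ν, z * Circle.exp (-ν)] *
                  (Matrix.GeneralLinearGroup.mkOfDetNeZero !![(1 : ℂ), 1; 1, -1] det_cayleyTwo_ne_zero)⁻¹,
                cayley_conj_circleDiagonal_mem_archLocal L w₀ _⟩ * h⁻¹ :
              archLocal L 2 (Matrix.of fun i j : Fin 2 => if i.val + j.val + 1 = 2 then (1 : L) else 0) w₀) : GL (Fin 2) ℂ) : Matrix (Fin 2) (Fin 2) ℂ) ∂ν₀) +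
         (∫ h : archLocal L 2 (Matrix.of fun i j : Fin 2 => if i.val + j.val + 1 = 2 then (1 : L) else 0) w₀,
            f₀ (((h * ⟨Matrix.GeneralLinearGroup.mkOfDetNeZero !![(1 : ℂ), 1; 1, -1] det_cayleyTwo_ne_zero *
                  circleDiagonal 2 ![z * Circle.exp (-ν), z * Circle.exp (-(-ν))] *
                  (Matrix.GeneralLinearGroup.mkOfDetNeZero !![(1 : ℂ), 1; 1, -1] det_cayleyTwo_ne_zero)⁻¹,
                cayley_conj_circleDiagonal_mem_archLocal L w₀ _⟩ * h⁻¹ :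
              archLocal L 2 (Matrix.of fun i j : Fin 2 => if i.val + j.val + 1 = 2 then (1 : L) else 0) w₀) : GL (Fin 2) ℂ) : Matrix (Fin 2) (Fin 2) ℂ) ∂ν₀))) := by
    intro ν hν hν0
    have hc : s + ν • nrm w₀ ∈ RegS S := add_smul_nrm_mem_regS S hw₀ hs hreg hregS hν hν0
    rw [stOrbFamH_of_mem_regS L νH fH S hc, ← stableSum_def, archRH_mul_stableSum_eq_mul_prod S hP hG hc,
      ← Finset.mul_prod_erase Finset.univ _ (Finset.mem_univ w₀), if_neg hw₀]
    -- the spectator factors and `G` are constant along the curve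
    have hGs : G (s + ν • nrm w₀) = G s := hG1 _ _ fun w => add_smul_nrm_apply_one s ν w₀ w
    have hspec : ∏ w ∈ Finset.univ.erase w₀, (if w ∈ S then (((|Real.exp ((s + ν • nrm w₀) w 0) - Real.exp (-(s + ν • nrm w₀) w 0)| : ℝ) : ℂ) * φ w ((s + ν • nrm w₀) w))
        else (1 - (Circle.exp ((s + ν • nrm w₀) w 2 - (s + ν • nrm w₀) w 0) : ℂ)) * (φ w ((s + ν • nrm w₀) w) + φ w ![(s + ν • nrm w₀) w 2, (s + ν • nrm w₀) w 1, (s + ν • nrm w₀) w 0])) =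
        ∏ w ∈ Finset.univ.erase w₀, (if w ∈ S then (((|Real.exp (s w 0) - Real.exp (-s w 0)| : ℝ) : ℂ) * φ w (s w))
        else (1 - (Circle.exp (s w 2 - s w 0) : ℂ)) * (φ w (s w) + φ w ![s w 2, s w 1, s w 0])) :=
      Finset.prod_congr rfl fun w hw => by rw [add_smul_nrm_apply_of_ne s ν (Finset.ne_of_mem_erase hw)]
    rw [hGs, hspec]
    -- the `w₀`-factor through `hQ` and the Cayley-torus angles
    have h0 : Circle.exp ((s + ν • nrm w₀) w₀ 0) = z * Circle.exp ν := circleExp_add_smul_nrm₀ s ν w₀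
    have h2 : Circle.exp ((s + ν • nrm w₀) w₀ 2) = z * Circle.exp (-ν) := circleExp_add_smul_nrm₂ s ν w₀ hs
    have hflip0 : Circle.exp ((![(s + ν • nrm w₀) w₀ 2, (s + ν • nrm w₀) w₀ 1, (s + ν • nrm w₀) w₀ 0] : Fin 3 → ℝ) 0) = z * Circle.exp (-ν) := by
      simp only [Matrix.cons_val_zero]; exact h2
    have hflip2 : Circle.exp ((![(s + ν • nrm w₀) w₀ 2, (s + ν • nrm w₀) w₀ 1, (s + ν • nrm w₀) w₀ 0] : Fin 3 → ℝ) 2) = z * Circle.exp (-(-ν)) := by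
      simp only [Matrix.cons_val_two, Matrix.tail_cons, Matrix.head_cons, neg_neg]; exact h0
    -- the integral as a function of the two circle angles
    have hI : ∀ (a b a' b' : Circle), a = a' → b = b' →
        (∫ h : archLocal L 2 (Matrix.of fun i j : Fin 2 => if i.val + j.val + 1 = 2 then (1 : L) else 0) w₀,
            f₀ (((h * ⟨Matrix.GeneralLinearGroup.mkOfDetNeZero !![(1 : ℂ), 1; 1, -1] det_cayleyTwo_ne_zero * circleDiagonal 2 ![a, b] *
                  (Matrix.GeneralLinearGroup.mkOfDetNeZero !![(1 : ℂ), 1; 1, -1] det_cayleyTwo_ne_zero)⁻¹,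
                cayley_conj_circleDiagonal_mem_archLocal L w₀ _⟩ * h⁻¹ :
              archLocal L 2 (Matrix.of fun i j : Fin 2 => if i.val + j.val + 1 = 2 then (1 : L) else 0) w₀) : GL (Fin 2) ℂ) : Matrix (Fin 2) (Fin 2) ℂ) ∂ν₀) =
        (∫ h : archLocal L 2 (Matrix.of fun i j : Fin 2 => if i.val + j.val + 1 = 2 then (1 : L) else 0) w₀,
            f₀ (((h * ⟨Matrix.GeneralLinearGroup.mkOfDetNeZero !![(1 : ℂ), 1; 1, -1] det_cayleyTwo_ne_zero * circleDiagonal 2 ![a', b'] *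
                  (Matrix.GeneralLinearGroup.mkOfDetNeZero !![(1 : ℂ), 1; 1, -1] det_cayleyTwo_ne_zero)⁻¹,
                cayley_conj_circleDiagonal_mem_archLocal L w₀ _⟩ * h⁻¹ :
              archLocal L 2 (Matrix.of fun i j : Fin 2 => if i.val + j.val + 1 = 2 then (1 : L) else 0) w₀) : GL (Fin 2) ℂ) : Matrix (Fin 2) (Fin 2) ℂ) ∂ν₀) := by
      rintro a b a' b' rfl rfl; rfl
    rw [hQ, hQ, hI _ _ _ _ h0 h2, hI _ _ _ _ hflip0 hflip2, one_sub_circleExp_add_smul_nrm s ν w₀ hs, hA]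
    ring
  -- transfer the jump of ★ p850182 along the eventual equality on both punctured sides
  have hres := HasOneSidedJump.congr_nhdsWithin hjump
    (by filter_upwards [Ioo_mem_nhdsGT (zero_lt_one' ℝ)] with ν hν
        exact key ν ⟨by linarith [hν.1], hν.2⟩ hν.1.ne')
    (by filter_upwards [Ioo_mem_nhdsLT (show (-1 : ℝ) < 0 by norm_num)] with ν hν
        exact key ν ⟨hν.1, by linarith [hν.2]⟩ hν.2.ne)
  exact HasOneSidedJump.jump_congr hres (mul_assoc _ _ _)

end Jump

end Literature.NumberTheory.Rogawski1990

end
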